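import Literature.Analysis.FluidPDE.TaoCarlemanFirstIneq
import HarnessLib

/-!
# Tao 2021, Props. 4.2 / 4.3 for fields that are regular only on a shell / a ball

Analysis/FluidPDE proof file (theorems only, no definitions, no named facts).

`TaoCarleman.first_carleman_inequality` (Prop. 4.2) and `TaoCarleman.second_carleman_inequality`
(Prop. 4.3) are proved in the tree for fields `u : [0,T] × E → F` whose uncurried field is of
class `C²` on the WHOLE closed slab `[0,T] × E`. Tao states both propositions for functions that
are smooth only on the cylindrical annulus `[0,T] × {r₋ ≤ |x| ≤ r₊}` (Prop. 4.2, p. 29) resp. on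
the cylinder `[0,T] × B(0,r)` (Prop. 4.3, p. 32) — "all functions are understood to be
restricted to the cylindrical annulus / to the cylinder" — and this locality is exactly what the
application in §5 uses: the backward vorticity of a solution that is regular only on a shell of
regularity `Ω = [−T₂, 0] × {R ≤ |x| ≤ A₆R}` ((5.10), p. 38) resp. on an epoch of regularity.

This file removes the global hypothesis: it suffices that `uncurry u` is `C²` on
`[0,T] × {ρ₁ < |x| < ρ₂}` for some `ρ₁ < r₋`, `r₊ < ρ₂` (Prop. 4.2), resp. on `[0,T] × B(0,ρ)`
for some `ρ > r` (Prop. 4.3). The reduction is the obvious one: multiply `u` by a smooth spatial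
cut-off `χ` which is `≡ 1` on a neighbourhood of the closed annulus / ball and vanishes near the
complement of the open set of regularity; `χ u` is then `C²` on the whole slab, the differential
inequality (4.4) and all three integrals of the conclusion only see points where `χ ≡ 1` nearby,
so the global theorem applied to `χ u` is literally the statement for `u`. The constants `K` are
those of the global theorems.

* `TaoCarleman.first_carleman_inequality_of_shell` — Prop. 4.2 under
  `ContDiffOn ℝ 2 (uncurry u) (Icc 0 T ×ˢ {x | ρ₁ < ‖x‖ ∧ ‖x‖ < ρ₂})`, `ρ₁ < r₁`, `r₂ < ρ₂`;
* `TaoCarleman.second_carleman_inequality_of_ball` — Prop. 4.3 under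
  `ContDiffOn ℝ 2 (uncurry u) (Icc 0 T ×ˢ ball 0 ρ)`, `r < ρ`;
* `TaoCarleman.first_carleman_inequality_lintegral`, `TaoCarleman.second_carleman_inequality_lintegral`
  — the same two statements as `ℝ≥0∞`-valued (`∫⁻`) inequalities over the CLOSED annulus / ball,
  with the regularity hypothesis "`C²` on an open set `O ⊇ [0,T] × (closed region)`";
* private tools: `contDiffOn_cutoff_smul` (a cut-off product is `Cⁿ` on the slab),
  `carleman_data_congr` (the data of (4.4) agree for fields that agree near a point),
  `exists_shell_cutoff`, `exists_ball_cutoff` (differences of Mathlib bump functions).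

## References

* T. Tao, *Quantitative bounds for critically bounded solutions to the Navier–Stokes equations*,
  arXiv:1908.04958v2 (2021), §4, Prop. 4.2 (p. 29: "restricted to the cylindrical annulus"),
  Prop. 4.3 (p. 32), and §5, p. 38 ((5.10) on the shell `Ω`). [Tao2021QuantitativeNS]
-/

noncomputable section

open MeasureTheory Set Function Filter Topology Metric
open scoped InnerProductSpace RealInnerProductSpace Laplacian

namespace Literature.Analysis.FluidPDE

namespace TaoCarleman

open Carleman

variable {E : Type*} [NormedAddCommGroup E] [InnerProductSpace ℝ E] [FiniteDimensional ℝ E]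
  [MeasurableSpace E] [BorelSpace E]
variable {F : Type*} [NormedAddCommGroup F] [InnerProductSpace ℝ F]

/-! ### Cut-off tools -/

section Tools

omit [FiniteDimensional ℝ E] [MeasurableSpace E] [BorelSpace E] in
/-- A spatial cut-off product `(t, x) ↦ χ(x) u(t, x)` is `Cⁿ` on the slab `A × E` as soon as
`u` is `Cⁿ` on `A × S`, `S` open, and `χ` vanishes near every point outside `S`. [folklore] -/
private theorem contDiffOn_cutoff_smul {u : ℝ → E → F} {χ : E → ℝ} {S : Set E} {A : Set ℝ}
    {n : WithTop ℕ∞} (hχ : ContDiff ℝ n χ) (hS : IsOpen S)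
    (hu : ContDiffOn ℝ n (uncurry u) (A ×ˢ S)) (hcover : ∀ x, x ∈ S ∨ χ =ᶠ[𝓝 x] 0) :
    ContDiffOn ℝ n (uncurry fun t x => χ x • u t x) (A ×ˢ univ) := by
  rintro ⟨t, x⟩ htx
  have ht : t ∈ A := (mem_prod.1 htx).1
  rcases hcover x with hx | hx
  · -- near a point of `S`: a product of `Cⁿ` functions
    have h1 : ContDiffWithinAt ℝ n (uncurry u) (A ×ˢ univ) (t, x) := by
      refine (hu (t, x) ⟨ht, hx⟩).mono_of_mem_nhdsWithin ?_
      rw [nhdsWithin_prod_eq]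
      exact prod_mem_prod self_mem_nhdsWithin (mem_nhdsWithin_of_mem_nhds (hS.mem_nhds hx))
    have h2 : ContDiffWithinAt ℝ n (fun z : ℝ × E => χ z.2) (A ×ˢ univ) (t, x) :=
      (hχ.comp contDiff_snd).contDiffWithinAt
    exact h2.smul h1
  · -- near a point where `χ` vanishes identically: the product is locally `0`
    have h0 : (uncurry fun t x => χ x • u t x) =ᶠ[𝓝 (t, x)] fun _ => 0 := by
      have h' : ∀ᶠ z : ℝ × E in 𝓝 (t, x), χ z.2 = (0 : E → ℝ) z.2 :=
        (continuous_snd.tendsto (t, x)).eventually hx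
      filter_upwards [h'] with z hz
      simp only [uncurry, hz, Pi.zero_apply, zero_smul]
    exact (contDiffWithinAt_const (c := (0 : F))).congr_of_eventuallyEq
      (h0.filter_mono nhdsWithin_le_nhds) h0.self_of_nhds

omit [MeasurableSpace E] [BorelSpace E] in
/-- If two time-dependent fields agree at the point `x` at all times and agree near `x` at time
`t`, then at `(t, x)` their time derivatives, Laplacians, spatial derivatives and values agree.
[folklore] -/
private theorem carleman_data_congr {u v : ℝ → E → F} {t : ℝ} {x : E}
    (hpt : ∀ s, v s x = u s x) (hev : v t =ᶠ[𝓝 x] u t) :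
    FluidPDE.timeDeriv v t x = FluidPDE.timeDeriv u t x ∧ Δ (v t) x = Δ (u t) x ∧
      fderiv ℝ (v t) x = fderiv ℝ (u t) x ∧ v t x = u t x := by
  refine ⟨?_, (InnerProductSpace.laplacian_congr_nhds hev).self_of_nhds, hev.fderiv_eq, hpt t⟩
  simp only [FluidPDE.timeDeriv_apply]
  rw [show (fun s => v s x) = fun s => u s x from funext hpt]

omit [MeasurableSpace E] [BorelSpace E] in
/-- **Smooth shell cut-off.** For `0 < ρ₁ < r₁ ≤ r₂ < ρ₂` there are a smooth `χ : E → ℝ` and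
`η > 0` with `χ ≡ 1` on the open shell `{r₁ − η < |x| < r₂ + η}` and `χ ≡ 0` near every point
outside the open shell `{ρ₁ < |x| < ρ₂}` (difference of two bump functions). [folklore] -/
private theorem exists_shell_cutoff {ρ₁ r₁ r₂ ρ₂ : ℝ} (hρ₁ : 0 < ρ₁) (h₁ : ρ₁ < r₁) (h₁₂ : r₁ ≤ r₂)
    (h₂ : r₂ < ρ₂) :
    ∃ χ : E → ℝ, ContDiff ℝ 2 χ ∧
      (∃ η : ℝ, 0 < η ∧ ∀ x : E, r₁ - η < ‖x‖ → ‖x‖ < r₂ + η → χ x = 1) ∧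
      ∀ x : E, ¬ (ρ₁ < ‖x‖ ∧ ‖x‖ < ρ₂) → χ =ᶠ[𝓝 x] 0 := by
  obtain ⟨η, hη⟩ : ∃ η : ℝ, η = min (r₁ - ρ₁) (ρ₂ - r₂) / 3 := ⟨_, rfl⟩
  have hη0 : 0 < η := by
    rw [hη]; exact div_pos (lt_min (by linarith) (by linarith)) (by norm_num)
  have hη1 : 3 * η ≤ r₁ - ρ₁ := by rw [hη]; linarith [min_le_left (r₁ - ρ₁) (ρ₂ - r₂)]
  have hη2 : 3 * η ≤ ρ₂ - r₂ := by rw [hη]; linarith [min_le_right (r₁ - ρ₁) (ρ₂ - r₂)]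
  let fo : ContDiffBump (0 : E) := ⟨r₂ + η, r₂ + 2 * η, by linarith, by linarith⟩
  let fi : ContDiffBump (0 : E) := ⟨r₁ - 2 * η, r₁ - η, by linarith, by linarith⟩
  refine ⟨fun x => fo x - fi x, ?_, ⟨η, hη0, fun x hx1 hx2 => ?_⟩, fun x hx => ?_⟩
  · exact (fo.contDiff (n := 2)).sub (fi.contDiff (n := 2))
  · have ho : fo x = 1 := fo.one_of_mem_closedBall (by
      rw [mem_closedBall, dist_zero_right]; exact hx2.le)
    have hi : fi x = 0 := fi.zero_of_le_dist (by rw [dist_zero_right]; exact hx1.le)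
    simp only [ho, hi, sub_zero]
  · -- outside the big shell: either deep inside, or far outside
    rcases le_or_gt ‖x‖ ρ₁ with hin | hout
    · have hU : ball (0 : E) (r₁ - 2 * η) ∈ 𝓝 x :=
        isOpen_ball.mem_nhds (by rw [mem_ball, dist_zero_right]; linarith)
      filter_upwards [hU] with y hy
      rw [mem_ball, dist_zero_right] at hy
      have ho : fo y = 1 := fo.one_of_mem_closedBall (by
        rw [mem_closedBall, dist_zero_right]; linarith)
      have hi : fi y = 1 := fi.one_of_mem_closedBall (by
        rw [mem_closedBall, dist_zero_right]; exact hy.le)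
      simp only [ho, hi, sub_self, Pi.zero_apply]
    · have hxρ₂ : ρ₂ ≤ ‖x‖ := by
        by_contra h
        exact hx ⟨hout, lt_of_not_ge h⟩
      have hU : (closedBall (0 : E) (r₂ + 2 * η))ᶜ ∈ 𝓝 x :=
        isClosed_closedBall.isOpen_compl.mem_nhds (by
          rw [mem_compl_iff, mem_closedBall, dist_zero_right, not_le]; linarith)
      filter_upwards [hU] with y hy
      rw [mem_compl_iff, mem_closedBall, dist_zero_right, not_le] at hy
      have ho : fo y = 0 := fo.zero_of_le_dist (by rw [dist_zero_right]; exact hy.le)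
      have hi : fi y = 0 := fi.zero_of_le_dist (by rw [dist_zero_right]; linarith)
      simp only [ho, hi, sub_self, Pi.zero_apply]

omit [MeasurableSpace E] [BorelSpace E] in
/-- **Smooth ball cut-off.** For `0 < r < ρ` there are a smooth `χ : E → ℝ` and `η > 0` with
`χ ≡ 1` on the open ball `B(0, r + η)` and `χ ≡ 0` near every point outside `B(0, ρ)`. [folklore] -/
private theorem exists_ball_cutoff {r ρ : ℝ} (hr : 0 < r) (hρ : r < ρ) :
    ∃ χ : E → ℝ, ContDiff ℝ 2 χ ∧ (∃ η : ℝ, 0 < η ∧ ∀ x : E, ‖x‖ < r + η → χ x = 1) ∧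
      ∀ x : E, x ∉ ball (0 : E) ρ → χ =ᶠ[𝓝 x] 0 := by
  obtain ⟨η, hη⟩ : ∃ η : ℝ, η = (ρ - r) / 3 := ⟨_, rfl⟩
  have hη0 : 0 < η := by rw [hη]; linarith
  let f : ContDiffBump (0 : E) := ⟨r + η, r + 2 * η, by linarith, by linarith⟩
  refine ⟨f, f.contDiff (n := 2), ⟨η, hη0, fun x hx => ?_⟩, fun x hx => ?_⟩
  · exact f.one_of_mem_closedBall (by rw [mem_closedBall, dist_zero_right]; exact hx.le)
  · rw [mem_ball, dist_zero_right, not_lt] at hx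
    have hU : (closedBall (0 : E) (r + 2 * η))ᶜ ∈ 𝓝 x :=
      isClosed_closedBall.isOpen_compl.mem_nhds (by
        rw [mem_compl_iff, mem_closedBall, dist_zero_right, not_le]; linarith)
    filter_upwards [hU] with y hy
    rw [mem_compl_iff, mem_closedBall, dist_zero_right, not_le] at hy
    exact f.zero_of_le_dist (by rw [dist_zero_right]; exact hy.le)

end Tools

/-! ### Prop. 4.2 for fields regular on an open shell -/

section Shell

/-- **Tao 2021, Proposition 4.2 (first Carleman inequality), local form.** The conclusion of
`first_carleman_inequality` — in dimension `3`, with the same absolute `K` — holds for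
`u : [0,T] × E → F` whose uncurried field is of class `C²` merely on `[0,T] × {ρ₁ < |x| < ρ₂}` for
some `ρ₁ < r₋`, `r₊ < ρ₂` (Tao: "all functions are understood to be restricted to the
cylindrical annulus `[0,T] × {r₋ ≤ |x| ≤ r₊}`", p. 29), obeying (4.4)
`|∂ₜu + Δu| ≤ (C₀T)⁻¹|u| + (C₀T)^{-1/2}|∇u|` on `]0,T[ × {r₋ ≤ |x| ≤ r₊}` and (4.5) `r₋² ≥ 4C₀T`:
`∫₀^{T/4} ∫_{10r₋<|x|<r₊/2} (T⁻¹|u|² + |∇u|²) ≤ K C₀³ e^{−r₋r₊/(4C₀T)} (X + e^{2r₊²/(C₀T)} Y)`,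
`X = ∫₀ᵀ ∫_{r₋<|x|<r₊} e^{2|x|²/(C₀T)} (T⁻¹|u|² + |∇u|²)`, `Y = ∫_{r₋<|x|<r₊} |u(0,x)|²`.
[cite: Tao2021QuantitativeNS, Prop. 4.2] -/
theorem first_carleman_inequality_of_shell (hd3 : Module.finrank ℝ E = 3) :
    ∃ K : ℝ, 0 < K ∧ ∀ (T C₀ ρ₁ r₁ r₂ ρ₂ : ℝ) (u : ℝ → E → F),
      0 < T → 1 ≤ C₀ → 0 < r₁ → r₁ < r₂ → ρ₁ < r₁ → r₂ < ρ₂ → 4 * C₀ * T ≤ r₁ ^ 2 →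
      ContDiffOn ℝ 2 (uncurry u) (Icc 0 T ×ˢ {x : E | ρ₁ < ‖x‖ ∧ ‖x‖ < ρ₂}) →
      (∀ t ∈ Ioo 0 T, ∀ x : E, r₁ ≤ ‖x‖ → ‖x‖ ≤ r₂ →
        ‖FluidPDE.timeDeriv u t x + Δ (u t) x‖ ≤
          (C₀ * T)⁻¹ * ‖u t x‖ + (Real.sqrt (C₀ * T))⁻¹ * ‖fderiv ℝ (u t) x‖) →
      ∫ t in (0 : ℝ)..T / 4, ∫ x in {y : E | 100 * r₁ ^ 2 < ‖y‖ ^ 2 ∧ ‖y‖ ^ 2 < r₂ ^ 2 / 4},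
          (T⁻¹ * ‖u t x‖ ^ 2 + ‖fderiv ℝ (u t) x‖ ^ 2) ≤
        K * C₀ ^ 3 * Real.exp (-(r₁ * r₂) / (4 * C₀ * T)) *
          ((∫ t in (0 : ℝ)..T, ∫ x in {y : E | r₁ ^ 2 < ‖y‖ ^ 2 ∧ ‖y‖ ^ 2 < r₂ ^ 2},
              Real.exp (2 * ‖x‖ ^ 2 / (C₀ * T)) * (T⁻¹ * ‖u t x‖ ^ 2 + ‖fderiv ℝ (u t) x‖ ^ 2)) +
            Real.exp (2 * r₂ ^ 2 / (C₀ * T)) * ∫ x in {y : E | r₁ ^ 2 < ‖y‖ ^ 2 ∧ ‖y‖ ^ 2 < r₂ ^ 2}, ‖u 0 x‖ ^ 2) := by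
  obtain ⟨K, hK, hmain⟩ := first_carleman_inequality (E := E) (F := F) hd3
  refine ⟨K, hK, ?_⟩
  intro T C₀ ρ₁ r₁ r₂ ρ₂ u hT hC₀ hr₁ hr₁₂ hρ₁ hρ₂ hr₁T hu hL
  have hr₂ : 0 < r₂ := hr₁.trans hr₁₂
  -- shrink the inner radius of regularity to a positive one
  set ρ₁' : ℝ := max ρ₁ (r₁ / 2) with hρ₁'
  have hρ₁'0 : 0 < ρ₁' := lt_of_lt_of_le (by linarith) (le_max_right _ _)
  have hρ₁'1 : ρ₁' < r₁ := max_lt hρ₁ (by linarith)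
  set S : Set E := {x : E | ρ₁' < ‖x‖ ∧ ‖x‖ < ρ₂} with hSdef
  have hSopen : IsOpen S :=
    (isOpen_lt continuous_const continuous_norm).inter (isOpen_lt continuous_norm continuous_const)
  have huS : ContDiffOn ℝ 2 (uncurry u) (Icc 0 T ×ˢ S) :=
    hu.mono (prod_mono le_rfl fun x hx => ⟨lt_of_le_of_lt (le_max_left _ _) hx.1, hx.2⟩)
  -- the cut-off and the cut-off field
  obtain ⟨χ, hχ, ⟨η, hη, hχ1⟩, hχ0⟩ := exists_shell_cutoff (E := E) hρ₁'0 hρ₁'1 hr₁₂.le hρ₂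
  set v : ℝ → E → F := fun t x => χ x • u t x with hvdef
  have hv : ContDiffOn ℝ 2 (uncurry v) (Icc 0 T ×ˢ univ) :=
    contDiffOn_cutoff_smul hχ hSopen huS fun x => by
      by_cases hx : ρ₁' < ‖x‖ ∧ ‖x‖ < ρ₂
      · exact Or.inl hx
      · exact Or.inr (hχ0 x hx)
  -- where `χ ≡ 1`
  set O : Set E := {x : E | r₁ - η < ‖x‖ ∧ ‖x‖ < r₂ + η} with hOdef
  have hOopen : IsOpen O :=
    (isOpen_lt continuous_const continuous_norm).inter (isOpen_lt continuous_norm continuous_const)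
  have hone : ∀ x ∈ O, ∀ s, v s x = u s x := fun x hx s => by
    simp only [hvdef, hχ1 x hx.1 hx.2, one_smul]
  have hev : ∀ x ∈ O, ∀ s, v s =ᶠ[𝓝 x] u s := fun x hx s => by
    filter_upwards [hOopen.mem_nhds hx] with y hy using hone y hy s
  have hdata : ∀ x ∈ O, ∀ s, FluidPDE.timeDeriv v s x = FluidPDE.timeDeriv u s x ∧
      Δ (v s) x = Δ (u s) x ∧ fderiv ℝ (v s) x = fderiv ℝ (u s) x ∧ v s x = u s x :=
    fun x hx s => carleman_data_congr (hone x hx) (hev x hx s)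
  have hO_of_sq : ∀ y : E, r₁ ^ 2 < ‖y‖ ^ 2 → ‖y‖ ^ 2 < r₂ ^ 2 → y ∈ O := fun y h1 h2 => by
    refine ⟨?_, ?_⟩
    · have := lt_of_pow_lt_pow_left₀ 2 (norm_nonneg y) h1
      linarith
    · have := lt_of_pow_lt_pow_left₀ 2 hr₂.le h2
      linarith
  -- (4.4) for `v`
  have hLv : ∀ t ∈ Ioo 0 T, ∀ x : E, r₁ ≤ ‖x‖ → ‖x‖ ≤ r₂ →
      ‖FluidPDE.timeDeriv v t x + Δ (v t) x‖ ≤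
        (C₀ * T)⁻¹ * ‖v t x‖ + (Real.sqrt (C₀ * T))⁻¹ * ‖fderiv ℝ (v t) x‖ := by
    intro t ht x hx1 hx2
    have hxO : x ∈ O := ⟨by linarith, by linarith⟩
    obtain ⟨e1, e2, e3, e4⟩ := hdata x hxO t
    rw [e1, e2, e3, e4]
    exact hL t ht x hx1 hx2
  have key := hmain T C₀ r₁ r₂ v hT hC₀ hr₁ hr₁₂ hr₁T hv hLv
  -- the three integrals only see points of `O`
  have hc : Continuous fun y : E => ‖y‖ ^ 2 := continuous_norm.pow 2
  have mS100 : MeasurableSet {y : E | 100 * r₁ ^ 2 < ‖y‖ ^ 2 ∧ ‖y‖ ^ 2 < r₂ ^ 2 / 4} :=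
    ((isOpen_lt continuous_const hc).inter (isOpen_lt hc continuous_const)).measurableSet
  have mSA : MeasurableSet {y : E | r₁ ^ 2 < ‖y‖ ^ 2 ∧ ‖y‖ ^ 2 < r₂ ^ 2} :=
    ((isOpen_lt continuous_const hc).inter (isOpen_lt hc continuous_const)).measurableSet
  have eL : (∫ t in (0 : ℝ)..T / 4, ∫ x in {y : E | 100 * r₁ ^ 2 < ‖y‖ ^ 2 ∧ ‖y‖ ^ 2 < r₂ ^ 2 / 4},
        (T⁻¹ * ‖v t x‖ ^ 2 + ‖fderiv ℝ (v t) x‖ ^ 2)) =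
      ∫ t in (0 : ℝ)..T / 4, ∫ x in {y : E | 100 * r₁ ^ 2 < ‖y‖ ^ 2 ∧ ‖y‖ ^ 2 < r₂ ^ 2 / 4},
        (T⁻¹ * ‖u t x‖ ^ 2 + ‖fderiv ℝ (u t) x‖ ^ 2) := by
    refine intervalIntegral.integral_congr fun t _ => setIntegral_congr_fun mS100 fun x hx => ?_
    have hxO : x ∈ O := hO_of_sq x (by nlinarith [hx.1, sq_nonneg r₁]) (by nlinarith [hx.2, sq_nonneg r₂])
    obtain ⟨-, -, e3, e4⟩ := hdata x hxO t
    simp only [e3, e4]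
  have eX : (∫ t in (0 : ℝ)..T, ∫ x in {y : E | r₁ ^ 2 < ‖y‖ ^ 2 ∧ ‖y‖ ^ 2 < r₂ ^ 2},
        Real.exp (2 * ‖x‖ ^ 2 / (C₀ * T)) * (T⁻¹ * ‖v t x‖ ^ 2 + ‖fderiv ℝ (v t) x‖ ^ 2)) =
      ∫ t in (0 : ℝ)..T, ∫ x in {y : E | r₁ ^ 2 < ‖y‖ ^ 2 ∧ ‖y‖ ^ 2 < r₂ ^ 2},
        Real.exp (2 * ‖x‖ ^ 2 / (C₀ * T)) * (T⁻¹ * ‖u t x‖ ^ 2 + ‖fderiv ℝ (u t) x‖ ^ 2) := by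
    refine intervalIntegral.integral_congr fun t _ => setIntegral_congr_fun mSA fun x hx => ?_
    obtain ⟨-, -, e3, e4⟩ := hdata x (hO_of_sq x hx.1 hx.2) t
    simp only [e3, e4]
  have eY : (∫ x in {y : E | r₁ ^ 2 < ‖y‖ ^ 2 ∧ ‖y‖ ^ 2 < r₂ ^ 2}, ‖v 0 x‖ ^ 2) =
      ∫ x in {y : E | r₁ ^ 2 < ‖y‖ ^ 2 ∧ ‖y‖ ^ 2 < r₂ ^ 2}, ‖u 0 x‖ ^ 2 := by
    refine setIntegral_congr_fun mSA fun x hx => ?_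
    obtain ⟨-, -, -, e4⟩ := hdata x (hO_of_sq x hx.1 hx.2) 0
    simp only [e4]
  rw [eL, eX, eY] at key
  exact key

end Shell

/-! ### Prop. 4.3 for fields regular on an open ball -/

section Ball

/-- **Tao 2021, Proposition 4.3 (second Carleman inequality), local form.** The conclusion of
`second_carleman_inequality` — in dimension `d ≤ 3`, with the same `K` — holds for
`u : [0,T] × E → F` whose uncurried field is of class `C²` merely on `[0,T] × B(0, ρ)` for some
`ρ > r` (Tao: "all functions are understood to be restricted to the cylinder `[0,T] × B(0,r)`",
p. 32), obeying (4.4) with `C₀ = 1` on `]0,T[ × B̄(0,r)`, `r² ≥ 4000T`, `0 < t₁ ≤ t₀ ≤ T/8000`: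
`∫_{t₀}^{2t₀} ∫_{|x|<r/2} (T⁻¹|u|² + |∇u|²) e^{−|x|²/4t}
  ≤ K (e^{−r²/(500 t₀)} X + t₀^{d/2} exp(K (r²/t₀) log(e t₀/t₁)) Y)`,
`X = ∫₀ᵀ ∫_{|x|<r} (T⁻¹|u|² + |∇u|²)`, `Y = ∫_{|x|<r} |u(0,x)|² t₁^{−d/2} e^{−|x|²/4t₁}`.
[cite: Tao2021QuantitativeNS, Prop. 4.3] -/
theorem second_carleman_inequality_of_ball (hd3 : Module.finrank ℝ E ≤ 3) :
    ∃ K : ℝ, 0 < K ∧ ∀ (T r ρ t₀ t₁ : ℝ) (u : ℝ → E → F),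
      0 < T → 0 < r → r < ρ → 4000 * T ≤ r ^ 2 → 0 < t₁ → t₁ ≤ t₀ → 8000 * t₀ ≤ T →
      ContDiffOn ℝ 2 (uncurry u) (Icc 0 T ×ˢ ball (0 : E) ρ) →
      (∀ t ∈ Ioo 0 T, ∀ x ∈ closedBall (0 : E) r,
        ‖FluidPDE.timeDeriv u t x + Δ (u t) x‖ ≤ T⁻¹ * ‖u t x‖ + (Real.sqrt T)⁻¹ * ‖fderiv ℝ (u t) x‖) →
      ∫ t in t₀..2 * t₀, ∫ x in ball (0 : E) (r / 2),
          (T⁻¹ * ‖u t x‖ ^ 2 + ‖fderiv ℝ (u t) x‖ ^ 2) * Real.exp (-‖x‖ ^ 2 / (4 * t)) ≤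
        K * (Real.exp (-r ^ 2 / (500 * t₀)) *
              (∫ t in (0 : ℝ)..T, ∫ x in ball (0 : E) r, (T⁻¹ * ‖u t x‖ ^ 2 + ‖fderiv ℝ (u t) x‖ ^ 2)) +
            t₀ ^ ((Module.finrank ℝ E : ℝ) / 2) *
              Real.exp (K * (r ^ 2 / t₀) * Real.log (Real.exp 1 * t₀ / t₁)) *
              ∫ x in ball (0 : E) r, ‖u 0 x‖ ^ 2 * (t₁ ^ (-(Module.finrank ℝ E : ℝ) / 2) *
                Real.exp (-‖x‖ ^ 2 / (4 * t₁)))) := by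
  obtain ⟨K, hK, hmain⟩ := second_carleman_inequality (E := E) (F := F) hd3
  refine ⟨K, hK, ?_⟩
  intro T r ρ t₀ t₁ u hT hr hrρ hrT ht₁ ht₁₀ ht₀ hu hL
  -- the cut-off and the cut-off field
  obtain ⟨χ, hχ, ⟨η, hη, hχ1⟩, hχ0⟩ := exists_ball_cutoff (E := E) hr hrρ
  set v : ℝ → E → F := fun t x => χ x • u t x with hvdef
  have hv : ContDiffOn ℝ 2 (uncurry v) (Icc 0 T ×ˢ univ) :=
    contDiffOn_cutoff_smul hχ isOpen_ball hu fun x => by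
      by_cases hx : x ∈ ball (0 : E) ρ
      · exact Or.inl hx
      · exact Or.inr (hχ0 x hx)
  -- where `χ ≡ 1`
  have hone : ∀ x ∈ ball (0 : E) (r + η), ∀ s, v s x = u s x := fun x hx s => by
    rw [mem_ball, dist_zero_right] at hx
    simp only [hvdef, hχ1 x hx, one_smul]
  have hev : ∀ x ∈ ball (0 : E) (r + η), ∀ s, v s =ᶠ[𝓝 x] u s := fun x hx s => by
    filter_upwards [isOpen_ball.mem_nhds hx] with y hy using hone y hy s
  have hdata : ∀ x ∈ ball (0 : E) (r + η), ∀ s,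
      FluidPDE.timeDeriv v s x = FluidPDE.timeDeriv u s x ∧
      Δ (v s) x = Δ (u s) x ∧ fderiv ℝ (v s) x = fderiv ℝ (u s) x ∧ v s x = u s x :=
    fun x hx s => carleman_data_congr (hone x hx) (hev x hx s)
  have hsub : ball (0 : E) r ⊆ ball (0 : E) (r + η) := ball_subset_ball (by linarith)
  have hsub2 : ball (0 : E) (r / 2) ⊆ ball (0 : E) (r + η) := ball_subset_ball (by linarith)
  have hsubc : closedBall (0 : E) r ⊆ ball (0 : E) (r + η) :=
    closedBall_subset_ball (by linarith)
  -- (4.4) for `v`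
  have hLv : ∀ t ∈ Ioo 0 T, ∀ x ∈ closedBall (0 : E) r,
      ‖FluidPDE.timeDeriv v t x + Δ (v t) x‖ ≤
        T⁻¹ * ‖v t x‖ + (Real.sqrt T)⁻¹ * ‖fderiv ℝ (v t) x‖ := by
    intro t ht x hx
    obtain ⟨e1, e2, e3, e4⟩ := hdata x (hsubc hx) t
    rw [e1, e2, e3, e4]
    exact hL t ht x hx
  have key := hmain T r t₀ t₁ v hT hr hrT ht₁ ht₁₀ ht₀ hv hLv
  have eL : (∫ t in t₀..2 * t₀, ∫ x in ball (0 : E) (r / 2),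
        (T⁻¹ * ‖v t x‖ ^ 2 + ‖fderiv ℝ (v t) x‖ ^ 2) * Real.exp (-‖x‖ ^ 2 / (4 * t))) =
      ∫ t in t₀..2 * t₀, ∫ x in ball (0 : E) (r / 2),
        (T⁻¹ * ‖u t x‖ ^ 2 + ‖fderiv ℝ (u t) x‖ ^ 2) * Real.exp (-‖x‖ ^ 2 / (4 * t)) := by
    refine intervalIntegral.integral_congr fun t _ =>
      setIntegral_congr_fun measurableSet_ball fun x hx => ?_
    obtain ⟨-, -, e3, e4⟩ := hdata x (hsub2 hx) t
    simp only [e3, e4]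
  have eX : (∫ t in (0 : ℝ)..T, ∫ x in ball (0 : E) r,
        (T⁻¹ * ‖v t x‖ ^ 2 + ‖fderiv ℝ (v t) x‖ ^ 2)) =
      ∫ t in (0 : ℝ)..T, ∫ x in ball (0 : E) r, (T⁻¹ * ‖u t x‖ ^ 2 + ‖fderiv ℝ (u t) x‖ ^ 2) := by
    refine intervalIntegral.integral_congr fun t _ =>
      setIntegral_congr_fun measurableSet_ball fun x hx => ?_
    obtain ⟨-, -, e3, e4⟩ := hdata x (hsub hx) t
    simp only [e3, e4]
  have eY : (∫ x in ball (0 : E) r, ‖v 0 x‖ ^ 2 * (t₁ ^ (-(Module.finrank ℝ E : ℝ) / 2) *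
        Real.exp (-‖x‖ ^ 2 / (4 * t₁)))) =
      ∫ x in ball (0 : E) r, ‖u 0 x‖ ^ 2 * (t₁ ^ (-(Module.finrank ℝ E : ℝ) / 2) *
        Real.exp (-‖x‖ ^ 2 / (4 * t₁))) := by
    refine setIntegral_congr_fun measurableSet_ball fun x hx => ?_
    obtain ⟨-, -, -, e4⟩ := hdata x (hsub hx) 0
    simp only [e4]
  rw [eL, eX, eY] at key
  exact key

end Ball

/-! ### The same two propositions in `ℝ≥0∞`-valued (`∫⁻`) currency on CLOSED regions

For consumers whose fields come from weak solutions it is convenient to have the conclusions as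
inequalities between extended non-negative integrals over the closed cylindrical annulus / the
closed cylinder (no integrability side conditions, no Bochner junk values), with the regularity
hypothesis phrased as "`C²` on an open neighbourhood of the closed region" (Tao's "smooth on
`[0,T] × {r₋ ≤ |x| ≤ r₊}`"). The passage is bookkeeping: a tube-lemma/thickening step produces
the open shell / ball of the local theorems above, spheres are Lebesgue-null, and on compact sets
the continuous integrands are integrable, so `∫⁻ ofReal = ofReal ∫` (Fubini for the space–time
integrals). -/

section Lintegral

omit [MeasurableSpace E] [BorelSpace E] in
/-- An open set containing the closed shell `{r₁ ≤ |x| ≤ r₂}` (`0 < r₁ ≤ r₂`) contains an open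
radial shell `{ρ₁ < |x| < ρ₂}` with `ρ₁ < r₁`, `r₂ < ρ₂`. [folklore] -/
private theorem exists_radialShell_subset {V : Set E} {r₁ r₂ : ℝ} (hr₁ : 0 < r₁) (hr₁₂ : r₁ ≤ r₂)
    (hV : IsOpen V) (hKV : {x : E | r₁ ≤ ‖x‖ ∧ ‖x‖ ≤ r₂} ⊆ V) :
    ∃ ρ₁ ρ₂ : ℝ, ρ₁ < r₁ ∧ r₂ < ρ₂ ∧ {x : E | ρ₁ < ‖x‖ ∧ ‖x‖ < ρ₂} ⊆ V := by
  have hKc : IsCompact {x : E | r₁ ≤ ‖x‖ ∧ ‖x‖ ≤ r₂} :=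
    Metric.isCompact_of_isClosed_isBounded
      ((isClosed_le continuous_const continuous_norm).inter
        (isClosed_le continuous_norm continuous_const))
      (isBounded_closedBall.subset fun _ hx => mem_closedBall_zero_iff.2 hx.2)
  obtain ⟨δ, hδ, hδV⟩ := hKc.exists_cthickening_subset_open hV hKV
  obtain ⟨δ', hδ'⟩ : ∃ δ' : ℝ, δ' = min δ r₁ / 2 := ⟨_, rfl⟩
  have hδ'0 : 0 < δ' := by rw [hδ']; exact div_pos (lt_min hδ hr₁) two_pos
  have hδ'δ : δ' < δ := by
    rw [hδ']; linarith [min_le_left δ r₁, lt_min hδ hr₁]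
  have hδ'r : δ' < r₁ := by
    rw [hδ']; linarith [min_le_right δ r₁, lt_min hδ hr₁]
  refine ⟨r₁ - δ', r₂ + δ', by linarith, by linarith, fun x hx => hδV ?_⟩
  apply thickening_subset_cthickening
  rw [mem_thickening_iff]
  have hx0 : 0 < ‖x‖ := by linarith [hx.1]
  -- the radial projection of `x` onto the closed shell
  obtain ⟨c, hc1, hc2, hcd⟩ : ∃ c : ℝ, r₁ ≤ c ∧ c ≤ r₂ ∧ |‖x‖ - c| < δ := by
    rcases le_or_gt r₁ ‖x‖ with h1 | h1
    · rcases le_or_gt ‖x‖ r₂ with h2 | h2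
      · exact ⟨‖x‖, h1, h2, by rw [sub_self, abs_zero]; exact hδ⟩
      · exact ⟨r₂, hr₁₂, le_rfl, by rw [abs_of_nonneg (by linarith)]; linarith [hx.2]⟩
    · exact ⟨r₁, le_rfl, hr₁₂, by rw [abs_of_nonpos (by linarith)]; linarith [hx.1]⟩
  have hc0 : 0 < c := hr₁.trans_le hc1
  have hnz : ‖(c / ‖x‖) • x‖ = c := by
    rw [norm_smul, Real.norm_eq_abs, abs_of_pos (div_pos hc0 hx0), div_mul_cancel₀ _ hx0.ne']
  refine ⟨(c / ‖x‖) • x, ⟨by rw [hnz]; exact hc1, by rw [hnz]; exact hc2⟩, ?_⟩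
  have e1 : x - (c / ‖x‖) • x = (1 - c / ‖x‖) • x := by rw [sub_smul, one_smul]
  have e2 : (1 - c / ‖x‖) * ‖x‖ = ‖x‖ - c := by
    rw [sub_mul, one_mul, div_mul_cancel₀ _ hx0.ne']
  rw [← e2, abs_mul, abs_of_pos hx0] at hcd
  rwa [dist_eq_norm, e1, norm_smul, Real.norm_eq_abs]

omit [MeasurableSpace E] [BorelSpace E] in
/-- An open set containing the closed ball `B̄(0, r)` (`0 < r`) contains an open ball `B(0, ρ)`
with `ρ > r`. [folklore] -/
private theorem exists_ball_subset' {V : Set E} {r : ℝ} (hr : 0 < r) (hV : IsOpen V)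
    (hKV : closedBall (0 : E) r ⊆ V) : ∃ ρ : ℝ, r < ρ ∧ ball (0 : E) ρ ⊆ V := by
  obtain ⟨δ, hδ, hδV⟩ := (isCompact_closedBall (0 : E) r).exists_cthickening_subset_open hV hKV
  rw [cthickening_closedBall hδ.le hr.le] at hδV
  exact ⟨r + δ, by linarith, ball_subset_closedBall.trans (by rwa [add_comm] at hδV)⟩

omit [FiniteDimensional ℝ E] [MeasurableSpace E] [BorelSpace E] in
/-- On an open set on which `uncurry u` is `C²`, the slice derivative `(t, x) ↦ D(u t)(x)` is
continuous (it is `D(uncurry u)(t,x) ∘ (0, ·)`). [folklore] -/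
private theorem continuousOn_sliceFDeriv_of_isOpen {O : Set (ℝ × E)} (hO : IsOpen O)
    {u : ℝ → E → F} (hu : ContDiffOn ℝ 2 (uncurry u) O) :
    ContinuousOn (fun z : ℝ × E => fderiv ℝ (u z.1) z.2) O := by
  have hc : ContinuousOn
      (fun z : ℝ × E => (fderiv ℝ (uncurry u) z).comp (ContinuousLinearMap.inr ℝ ℝ E)) O :=
    (hu.continuousOn_fderiv_of_isOpen hO (by norm_num)).clm_comp continuousOn_const
  refine hc.congr fun z hz => ?_
  have hd : DifferentiableAt ℝ (uncurry u) (z.1, z.2) :=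
    differentiableAt_of_contDiffOn hO hu (by norm_num) hz
  exact (hasFDerivAt_slice hd).fderiv

/-- `∫⁻` over `[a,b] × K` of a continuous non-negative function equals `ofReal` of the iterated
Bochner integral over `]a,b] × S` when `S ⊆ K` carries all the mass of the compact set `K`.
[folklore] -/
private theorem setLIntegral_prod_eq_ofReal {a b : ℝ} (hab : a ≤ b) {Φ : ℝ × E → ℝ}
    {K S : Set E} (hK : IsCompact K) (hS : MeasurableSet S) (hSK : S ⊆ K)
    (hKS : volume (K \ S) = 0) (hΦ : ContinuousOn Φ (Icc a b ×ˢ K))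
    (hΦ0 : ∀ z ∈ Icc a b ×ˢ K, 0 ≤ Φ z) :
    ∫⁻ p in Icc a b ×ˢ K, ENNReal.ofReal (Φ p) =
      ENNReal.ofReal (∫ t in a..b, ∫ x in S, Φ (t, x)) := by
  have hae : (Icc a b ×ˢ K : Set (ℝ × E)) =ᵐ[volume] (Icc a b ×ˢ S : Set (ℝ × E)) := by
    refine ae_eq_set.2 ⟨?_, ?_⟩
    · have hsub : Icc a b ×ˢ K \ Icc a b ×ˢ S ⊆ Icc a b ×ˢ (K \ S) := by
        rintro ⟨t, x⟩ ⟨⟨ht, hx⟩, hn⟩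
        exact ⟨ht, hx, fun hxS => hn ⟨ht, hxS⟩⟩
      refine measure_mono_null hsub ?_
      rw [Measure.volume_eq_prod, Measure.prod_prod, hKS, mul_zero]
    · exact measure_mono_null (fun z hz => absurd (prod_mono le_rfl hSK hz.1) hz.2) measure_empty
  rw [Measure.restrict_congr_set hae]
  have hint : IntegrableOn Φ (Icc a b ×ˢ S) volume :=
    (hΦ.integrableOn_compact (isCompact_Icc.prod hK)).mono_set (prod_mono le_rfl hSK)
  have hnn : 0 ≤ᵐ[volume.restrict (Icc a b ×ˢ S)] Φ := by
    filter_upwards [ae_restrict_mem (measurableSet_Icc.prod hS)] with z hz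
    exact hΦ0 z ⟨hz.1, hSK hz.2⟩
  rw [← ofReal_integral_eq_lintegral_ofReal hint hnn]
  congr 1
  rw [Measure.volume_eq_prod] at hint ⊢
  rw [setIntegral_prod Φ hint, intervalIntegral.integral_of_le hab, integral_Icc_eq_integral_Ioc]

/-- `∫⁻` over a compact `K` of a continuous non-negative function equals `ofReal` of the Bochner
integral over `S` when `S ⊆ K` carries all the mass of `K`. [folklore] -/
private theorem setLIntegral_eq_ofReal {ψ : E → ℝ} {K S : Set E} (hK : IsCompact K)
    (hS : MeasurableSet S) (hSK : S ⊆ K) (hKS : volume (K \ S) = 0) (hψ : ContinuousOn ψ K)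
    (hψ0 : ∀ x ∈ K, 0 ≤ ψ x) :
    ∫⁻ x in K, ENNReal.ofReal (ψ x) = ENNReal.ofReal (∫ x in S, ψ x) := by
  have hae : (K : Set E) =ᵐ[volume] S := by
    refine ae_eq_set.2 ⟨hKS, ?_⟩
    exact measure_mono_null (fun x hx => absurd (hSK hx.1) hx.2) measure_empty
  rw [Measure.restrict_congr_set hae]
  have hint : IntegrableOn ψ S volume := (hψ.integrableOn_compact hK).mono_set hSK
  have hnn : 0 ≤ᵐ[volume.restrict S] ψ := by
    filter_upwards [ae_restrict_mem hS] with x hx using hψ0 x (hSK hx)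
  rw [← ofReal_integral_eq_lintegral_ofReal hint hnn]

/-- The closed shell `{a ≤ |x| ≤ b}` and the open shell `{a² < |x|² < b²}` differ by two spheres,
a Lebesgue-null set. [folklore] -/
private theorem volume_closedShell_diff_sqShell {a b a' b' : ℝ} (ha : 0 < a) (hb : 0 < b)
    (ha' : a' = a ^ 2) (hb' : b' = b ^ 2) :
    volume ({x : E | a ≤ ‖x‖ ∧ ‖x‖ ≤ b} \ {y : E | a' < ‖y‖ ^ 2 ∧ ‖y‖ ^ 2 < b'}) = 0 := by
  have hsub : {x : E | a ≤ ‖x‖ ∧ ‖x‖ ≤ b} \ {y : E | a' < ‖y‖ ^ 2 ∧ ‖y‖ ^ 2 < b'} ⊆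
      sphere (0 : E) a ∪ sphere (0 : E) b := by
    rintro x ⟨⟨h1, h2⟩, hn⟩
    simp only [mem_setOf_eq, not_and, not_lt, ha', hb'] at hn
    rw [mem_union, mem_sphere_zero_iff_norm, mem_sphere_zero_iff_norm]
    by_cases h : a ^ 2 < ‖x‖ ^ 2
    · right
      have := hn h
      nlinarith [norm_nonneg x]
    · left
      push Not at h
      nlinarith [norm_nonneg x]
  exact measure_mono_null hsub
    (measure_union_null (Measure.addHaar_sphere_of_ne_zero volume 0 ha.ne')
      (Measure.addHaar_sphere_of_ne_zero volume 0 hb.ne'))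

omit [InnerProductSpace ℝ E] [FiniteDimensional ℝ E] [MeasurableSpace E] [BorelSpace E] in
/-- The open square-shell `{a² < |x|² < b²}` lies in the closed shell `{a ≤ |x| ≤ b}`. [folklore] -/
private theorem sqShell_subset_closedShell {a b a' b' : ℝ} (hb : 0 < b)
    (ha' : a' = a ^ 2) (hb' : b' = b ^ 2) :
    {y : E | a' < ‖y‖ ^ 2 ∧ ‖y‖ ^ 2 < b'} ⊆ {x : E | a ≤ ‖x‖ ∧ ‖x‖ ≤ b} := by
  rintro y ⟨h1, h2⟩
  rw [ha'] at h1
  rw [hb'] at h2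
  exact ⟨(lt_of_pow_lt_pow_left₀ 2 (norm_nonneg y) h1).le,
    (lt_of_pow_lt_pow_left₀ 2 hb.le h2).le⟩

omit [MeasurableSpace E] [BorelSpace E] in
/-- Closed shells are compact. [folklore] -/
private theorem isCompact_closedShell (a b : ℝ) : IsCompact {x : E | a ≤ ‖x‖ ∧ ‖x‖ ≤ b} :=
  Metric.isCompact_of_isClosed_isBounded
    ((isClosed_le continuous_const continuous_norm).inter
      (isClosed_le continuous_norm continuous_const))
    (isBounded_closedBall.subset fun _ hx => mem_closedBall_zero_iff.2 hx.2)

omit [InnerProductSpace ℝ E] [FiniteDimensional ℝ E] in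
/-- Open square-shells are measurable. [folklore] -/
private theorem measurableSet_sqShell (a' b' : ℝ) :
    MeasurableSet {y : E | a' < ‖y‖ ^ 2 ∧ ‖y‖ ^ 2 < b'} :=
  ((isOpen_lt continuous_const (continuous_norm.pow 2)).inter
    (isOpen_lt (continuous_norm.pow 2) continuous_const)).measurableSet

/-- **Tao 2021, Proposition 4.2 — `∫⁻` form on the closed annulus, regularity on an open
neighbourhood.** In dimension `3` there is an absolute `K > 0` such that: for `T > 0`, `C₀ ≥ 1`,
`0 < r₋ < r₊` with (4.5) `r₋² ≥ 4C₀T`, and `u : ℝ → E → F` with `uncurry u` of class `C²` on an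
open set `O ⊇ [0,T] × {r₋ ≤ |x| ≤ r₊}` obeying (4.4)
`|∂ₜu + Δu| ≤ (C₀T)⁻¹|u| + (C₀T)^{-1/2}|∇u|` on `]0,T[ × {r₋ ≤ |x| ≤ r₊}` (`|∇u|` the operator
norm of `D(u t)(x)`; backward clock, `t = 0` the final slice),
`∫⁻_{[0,T/4] × {10r₋ ≤ |x| ≤ r₊/2}} (T⁻¹|u|² + |∇u|²)
  ≤ K C₀³ e^{−r₋r₊/(4C₀T)} ( ∫⁻_{[0,T] × {r₋≤|x|≤r₊}} e^{2|x|²/(C₀T)}(T⁻¹|u|² + |∇u|²)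
    + e^{2r₊²/(C₀T)} ∫⁻_{r₋≤|x|≤r₊} |u(0,x)|² )`
in `ℝ≥0∞` (all integrands wrapped in `ENNReal.ofReal`; `ENNReal.ofReal (‖a‖ ^ 2) = ‖a‖ₑ ^ 2`).
Tao's `≲ C₀²` is rendered `K C₀³` as in `first_carleman_inequality` (see that docstring).
[cite: Tao2021QuantitativeNS, Prop. 4.2] -/
theorem first_carleman_inequality_lintegral (hd3 : Module.finrank ℝ E = 3) :
    ∃ K : ℝ, 0 < K ∧ ∀ (T C₀ r₁ r₂ : ℝ) (u : ℝ → E → F) (O : Set (ℝ × E)),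
      0 < T → 1 ≤ C₀ → 0 < r₁ → r₁ < r₂ → 4 * C₀ * T ≤ r₁ ^ 2 →
      IsOpen O → Icc 0 T ×ˢ {x : E | r₁ ≤ ‖x‖ ∧ ‖x‖ ≤ r₂} ⊆ O →
      ContDiffOn ℝ 2 (uncurry u) O →
      (∀ t ∈ Ioo 0 T, ∀ x : E, r₁ ≤ ‖x‖ → ‖x‖ ≤ r₂ →
        ‖FluidPDE.timeDeriv u t x + Δ (u t) x‖ ≤
          (C₀ * T)⁻¹ * ‖u t x‖ + (Real.sqrt (C₀ * T))⁻¹ * ‖fderiv ℝ (u t) x‖) →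
      (∫⁻ p in Icc 0 (T / 4) ×ˢ {x : E | 10 * r₁ ≤ ‖x‖ ∧ ‖x‖ ≤ r₂ / 2},
          ENNReal.ofReal (T⁻¹ * ‖u p.1 p.2‖ ^ 2 + ‖fderiv ℝ (u p.1) p.2‖ ^ 2)) ≤
        ENNReal.ofReal (K * C₀ ^ 3 * Real.exp (-(r₁ * r₂) / (4 * C₀ * T))) *
          ((∫⁻ p in Icc 0 T ×ˢ {x : E | r₁ ≤ ‖x‖ ∧ ‖x‖ ≤ r₂},
              ENNReal.ofReal (Real.exp (2 * ‖p.2‖ ^ 2 / (C₀ * T)) *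
                (T⁻¹ * ‖u p.1 p.2‖ ^ 2 + ‖fderiv ℝ (u p.1) p.2‖ ^ 2))) +
            ENNReal.ofReal (Real.exp (2 * r₂ ^ 2 / (C₀ * T))) *
              ∫⁻ x in {x : E | r₁ ≤ ‖x‖ ∧ ‖x‖ ≤ r₂}, ENNReal.ofReal (‖u 0 x‖ ^ 2)) := by
  obtain ⟨K, hK, hmain⟩ := first_carleman_inequality_of_shell (E := E) (F := F) hd3
  refine ⟨K, hK, ?_⟩
  intro T C₀ r₁ r₂ u O hT hC₀ hr₁ hr₁₂ hr₁T hO hKO hu hL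
  have hr₂ : 0 < r₂ := hr₁.trans hr₁₂
  have hC₀0 : 0 < C₀ := by linarith
  -- an open radial shell of regularity
  obtain ⟨U, V, hUo, hVo, hIU, hKV, hUV⟩ :=
    generalized_tube_lemma isCompact_Icc (isCompact_closedShell (E := E) r₁ r₂) hO hKO
  obtain ⟨ρ₁, ρ₂, hρ₁, hρ₂, hshell⟩ := exists_radialShell_subset hr₁ hr₁₂.le hVo hKV
  have hu' : ContDiffOn ℝ 2 (uncurry u) (Icc 0 T ×ˢ {x : E | ρ₁ < ‖x‖ ∧ ‖x‖ < ρ₂}) :=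
    hu.mono ((prod_mono hIU hshell).trans hUV)
  have key := hmain T C₀ ρ₁ r₁ r₂ ρ₂ u hT hC₀ hr₁ hr₁₂ hρ₁ hρ₂ hr₁T hu' hL
  -- continuity of the integrands on `O`
  have hcu : ContinuousOn (uncurry u) O := hu.continuousOn
  have hcD : ContinuousOn (fun z : ℝ × E => fderiv ℝ (u z.1) z.2) O :=
    continuousOn_sliceFDeriv_of_isOpen hO hu
  have hΦ : ContinuousOn (fun z : ℝ × E => T⁻¹ * ‖u z.1 z.2‖ ^ 2 + ‖fderiv ℝ (u z.1) z.2‖ ^ 2) O :=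
    (continuousOn_const.mul (hcu.norm.pow 2)).add (hcD.norm.pow 2)
  have hΦX : ContinuousOn (fun z : ℝ × E => Real.exp (2 * ‖z.2‖ ^ 2 / (C₀ * T)) *
      (T⁻¹ * ‖u z.1 z.2‖ ^ 2 + ‖fderiv ℝ (u z.1) z.2‖ ^ 2)) O :=
    (Real.continuous_exp.comp ((continuous_const.mul (continuous_snd.norm.pow 2)).div_const _)
      ).continuousOn.mul hΦ
  have hψ : ContinuousOn (fun x : E => ‖u 0 x‖ ^ 2) {x : E | r₁ ≤ ‖x‖ ∧ ‖x‖ ≤ r₂} :=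
    ((hcu.comp (continuous_const.prodMk continuous_id).continuousOn
      fun x hx => hKO ⟨left_mem_Icc.2 hT.le, hx⟩).norm).pow 2
  -- the sets
  have hKinKA : Icc 0 (T / 4) ×ˢ {x : E | 10 * r₁ ≤ ‖x‖ ∧ ‖x‖ ≤ r₂ / 2} ⊆
      Icc 0 T ×ˢ {x : E | r₁ ≤ ‖x‖ ∧ ‖x‖ ≤ r₂} :=
    prod_mono (Icc_subset_Icc le_rfl (by linarith)) fun x hx => ⟨by linarith [hx.1], by linarith [hx.2]⟩
  -- the three conversions
  have eL : (∫⁻ p in Icc 0 (T / 4) ×ˢ {x : E | 10 * r₁ ≤ ‖x‖ ∧ ‖x‖ ≤ r₂ / 2},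
        ENNReal.ofReal (T⁻¹ * ‖u p.1 p.2‖ ^ 2 + ‖fderiv ℝ (u p.1) p.2‖ ^ 2)) =
      ENNReal.ofReal (∫ t in (0 : ℝ)..T / 4,
        ∫ x in {y : E | 100 * r₁ ^ 2 < ‖y‖ ^ 2 ∧ ‖y‖ ^ 2 < r₂ ^ 2 / 4},
          (T⁻¹ * ‖u t x‖ ^ 2 + ‖fderiv ℝ (u t) x‖ ^ 2)) :=
    setLIntegral_prod_eq_ofReal (Φ := fun z : ℝ × E =>
        T⁻¹ * ‖u z.1 z.2‖ ^ 2 + ‖fderiv ℝ (u z.1) z.2‖ ^ 2) (by positivity)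
      (isCompact_closedShell _ _) (measurableSet_sqShell _ _)
      (sqShell_subset_closedShell (by positivity) (by ring) (by ring))
      (volume_closedShell_diff_sqShell (by positivity) (by positivity) (by ring) (by ring))
      (hΦ.mono (hKinKA.trans hKO)) (fun z _ => by positivity)
  have eX : (∫⁻ p in Icc 0 T ×ˢ {x : E | r₁ ≤ ‖x‖ ∧ ‖x‖ ≤ r₂},
        ENNReal.ofReal (Real.exp (2 * ‖p.2‖ ^ 2 / (C₀ * T)) *
          (T⁻¹ * ‖u p.1 p.2‖ ^ 2 + ‖fderiv ℝ (u p.1) p.2‖ ^ 2))) =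
      ENNReal.ofReal (∫ t in (0 : ℝ)..T, ∫ x in {y : E | r₁ ^ 2 < ‖y‖ ^ 2 ∧ ‖y‖ ^ 2 < r₂ ^ 2},
        Real.exp (2 * ‖x‖ ^ 2 / (C₀ * T)) * (T⁻¹ * ‖u t x‖ ^ 2 + ‖fderiv ℝ (u t) x‖ ^ 2)) :=
    setLIntegral_prod_eq_ofReal (Φ := fun z : ℝ × E => Real.exp (2 * ‖z.2‖ ^ 2 / (C₀ * T)) *
        (T⁻¹ * ‖u z.1 z.2‖ ^ 2 + ‖fderiv ℝ (u z.1) z.2‖ ^ 2)) hT.le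
      (isCompact_closedShell _ _) (measurableSet_sqShell _ _)
      (sqShell_subset_closedShell hr₂ rfl rfl)
      (volume_closedShell_diff_sqShell hr₁ hr₂ rfl rfl)
      (hΦX.mono hKO) (fun z _ => by positivity)
  have eY : (∫⁻ x in {x : E | r₁ ≤ ‖x‖ ∧ ‖x‖ ≤ r₂}, ENNReal.ofReal (‖u 0 x‖ ^ 2)) =
      ENNReal.ofReal (∫ x in {y : E | r₁ ^ 2 < ‖y‖ ^ 2 ∧ ‖y‖ ^ 2 < r₂ ^ 2}, ‖u 0 x‖ ^ 2) :=
    setLIntegral_eq_ofReal (ψ := fun x : E => ‖u 0 x‖ ^ 2) (isCompact_closedShell _ _)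
      (measurableSet_sqShell _ _) (sqShell_subset_closedShell hr₂ rfl rfl)
      (volume_closedShell_diff_sqShell hr₁ hr₂ rfl rfl) hψ (fun x _ => by positivity)
  rw [eL, eX, eY]
  -- assemble in `ℝ≥0∞`
  have mSA := measurableSet_sqShell (E := E) (r₁ ^ 2) (r₂ ^ 2)
  have hX0 : 0 ≤ ∫ t in (0 : ℝ)..T, ∫ x in {y : E | r₁ ^ 2 < ‖y‖ ^ 2 ∧ ‖y‖ ^ 2 < r₂ ^ 2},
      Real.exp (2 * ‖x‖ ^ 2 / (C₀ * T)) * (T⁻¹ * ‖u t x‖ ^ 2 + ‖fderiv ℝ (u t) x‖ ^ 2) :=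
    intervalIntegral.integral_nonneg hT.le fun t _ =>
      setIntegral_nonneg mSA fun x _ => by positivity
  have hY0 : 0 ≤ ∫ x in {y : E | r₁ ^ 2 < ‖y‖ ^ 2 ∧ ‖y‖ ^ 2 < r₂ ^ 2}, ‖u 0 x‖ ^ 2 :=
    setIntegral_nonneg mSA fun x _ => by positivity
  have he : 0 ≤ Real.exp (2 * r₂ ^ 2 / (C₀ * T)) := (Real.exp_pos _).le
  have hKC : 0 ≤ K * C₀ ^ 3 * Real.exp (-(r₁ * r₂) / (4 * C₀ * T)) := by positivity
  rw [← ENNReal.ofReal_mul he, ← ENNReal.ofReal_add hX0 (mul_nonneg he hY0),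
    ← ENNReal.ofReal_mul hKC]
  exact ENNReal.ofReal_le_ofReal key

/-- **Tao 2021, Proposition 4.3 — `∫⁻` form on the closed cylinder, regularity on an open
neighbourhood.** In dimension `d ≤ 3` there is an absolute `K > 0` such that: for `T, r > 0`
with (4.10) `r² ≥ 4000T`, times `0 < t₁ ≤ t₀` with `8000 t₀ ≤ T` (see
`second_carleman_inequality` for this rendering of (4.11)), and `u : ℝ → E → F` with `uncurry u`
of class `C²` on an open set `O ⊇ [0,T] × B̄(0,r)` obeying (4.4) with `C₀ = 1` on
`]0,T[ × B̄(0,r)`,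
`∫⁻_{[t₀,2t₀] × B̄(0,r/2)} (T⁻¹|u|² + |∇u|²) e^{−|x|²/4t}
  ≤ K ( e^{−r²/(500t₀)} ∫⁻_{[0,T] × B̄(0,r)} (T⁻¹|u|² + |∇u|²)
      + t₀^{d/2} e^{K (r²/t₀) log(e t₀/t₁)} ∫⁻_{B̄(0,r)} |u(0,x)|² t₁^{−d/2} e^{−|x|²/4t₁} )`
in `ℝ≥0∞`. [cite: Tao2021QuantitativeNS, Prop. 4.3] -/
theorem second_carleman_inequality_lintegral (hd3 : Module.finrank ℝ E ≤ 3) :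
    ∃ K : ℝ, 0 < K ∧ ∀ (T r t₀ t₁ : ℝ) (u : ℝ → E → F) (O : Set (ℝ × E)),
      0 < T → 0 < r → 4000 * T ≤ r ^ 2 → 0 < t₁ → t₁ ≤ t₀ → 8000 * t₀ ≤ T →
      IsOpen O → Icc 0 T ×ˢ closedBall (0 : E) r ⊆ O → ContDiffOn ℝ 2 (uncurry u) O →
      (∀ t ∈ Ioo 0 T, ∀ x ∈ closedBall (0 : E) r,
        ‖FluidPDE.timeDeriv u t x + Δ (u t) x‖ ≤ T⁻¹ * ‖u t x‖ + (Real.sqrt T)⁻¹ * ‖fderiv ℝ (u t) x‖) →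
      (∫⁻ p in Icc t₀ (2 * t₀) ×ˢ closedBall (0 : E) (r / 2),
          ENNReal.ofReal ((T⁻¹ * ‖u p.1 p.2‖ ^ 2 + ‖fderiv ℝ (u p.1) p.2‖ ^ 2) *
            Real.exp (-‖p.2‖ ^ 2 / (4 * p.1)))) ≤
        ENNReal.ofReal K *
          (ENNReal.ofReal (Real.exp (-r ^ 2 / (500 * t₀))) *
              (∫⁻ p in Icc 0 T ×ˢ closedBall (0 : E) r,
                ENNReal.ofReal (T⁻¹ * ‖u p.1 p.2‖ ^ 2 + ‖fderiv ℝ (u p.1) p.2‖ ^ 2)) +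
            ENNReal.ofReal (t₀ ^ ((Module.finrank ℝ E : ℝ) / 2) *
                Real.exp (K * (r ^ 2 / t₀) * Real.log (Real.exp 1 * t₀ / t₁))) *
              ∫⁻ x in closedBall (0 : E) r, ENNReal.ofReal (‖u 0 x‖ ^ 2 *
                (t₁ ^ (-(Module.finrank ℝ E : ℝ) / 2) * Real.exp (-‖x‖ ^ 2 / (4 * t₁))))) := by
  obtain ⟨K, hK, hmain⟩ := second_carleman_inequality_of_ball (E := E) (F := F) hd3
  refine ⟨K, hK, ?_⟩
  intro T r t₀ t₁ u O hT hr hrT ht₁ ht₁₀ ht₀ hO hKO hu hL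
  have ht₀0 : 0 < t₀ := lt_of_lt_of_le ht₁ ht₁₀
  -- an open ball of regularity
  obtain ⟨U, V, hUo, hVo, hIU, hKV, hUV⟩ :=
    generalized_tube_lemma isCompact_Icc (isCompact_closedBall (0 : E) r) hO hKO
  obtain ⟨ρ, hρ, hball⟩ := exists_ball_subset' hr hVo hKV
  have hu' : ContDiffOn ℝ 2 (uncurry u) (Icc 0 T ×ˢ ball (0 : E) ρ) :=
    hu.mono ((prod_mono hIU hball).trans hUV)
  have key := hmain T r ρ t₀ t₁ u hT hr hρ hrT ht₁ ht₁₀ ht₀ hu' hL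
  -- continuity of the integrands on `O`
  have hcu : ContinuousOn (uncurry u) O := hu.continuousOn
  have hcD : ContinuousOn (fun z : ℝ × E => fderiv ℝ (u z.1) z.2) O :=
    continuousOn_sliceFDeriv_of_isOpen hO hu
  have hΦ : ContinuousOn (fun z : ℝ × E => T⁻¹ * ‖u z.1 z.2‖ ^ 2 + ‖fderiv ℝ (u z.1) z.2‖ ^ 2) O :=
    (continuousOn_const.mul (hcu.norm.pow 2)).add (hcD.norm.pow 2)
  have hW : ContinuousOn (fun z : ℝ × E => Real.exp (-‖z.2‖ ^ 2 / (4 * z.1)))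
      (Icc t₀ (2 * t₀) ×ˢ closedBall (0 : E) (r / 2)) := by
    refine Real.continuous_exp.comp_continuousOn
      (((continuous_snd.norm.pow 2).neg).continuousOn.div
        (continuous_const.mul continuous_fst).continuousOn fun z hz => ?_)
    have : t₀ ≤ z.1 := (mem_prod.1 hz).1.1
    exact mul_ne_zero four_ne_zero (by linarith)
  have hLsub : Icc t₀ (2 * t₀) ×ˢ closedBall (0 : E) (r / 2) ⊆ Icc 0 T ×ˢ closedBall (0 : E) r :=
    prod_mono (Icc_subset_Icc ht₀0.le (by linarith)) (closedBall_subset_closedBall (by linarith))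
  have hψ : ContinuousOn (fun x : E => ‖u 0 x‖ ^ 2 *
      (t₁ ^ (-(Module.finrank ℝ E : ℝ) / 2) * Real.exp (-‖x‖ ^ 2 / (4 * t₁))))
      (closedBall (0 : E) r) :=
    (((hcu.comp (continuous_const.prodMk continuous_id).continuousOn
      fun x hx => hKO ⟨left_mem_Icc.2 hT.le, hx⟩).norm).pow 2).mul
      (continuous_const.mul (Real.continuous_exp.comp
        ((continuous_norm.pow 2).neg.div_const _))).continuousOn
  have hnull : ∀ s : ℝ, 0 < s → volume (closedBall (0 : E) s \ ball (0 : E) s) = 0 := fun s hs => by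
    rw [closedBall_sdiff_ball]
    exact Measure.addHaar_sphere_of_ne_zero volume 0 hs.ne'
  -- the three conversions
  have eL : (∫⁻ p in Icc t₀ (2 * t₀) ×ˢ closedBall (0 : E) (r / 2),
        ENNReal.ofReal ((T⁻¹ * ‖u p.1 p.2‖ ^ 2 + ‖fderiv ℝ (u p.1) p.2‖ ^ 2) *
          Real.exp (-‖p.2‖ ^ 2 / (4 * p.1)))) =
      ENNReal.ofReal (∫ t in t₀..2 * t₀, ∫ x in ball (0 : E) (r / 2),
        (T⁻¹ * ‖u t x‖ ^ 2 + ‖fderiv ℝ (u t) x‖ ^ 2) * Real.exp (-‖x‖ ^ 2 / (4 * t))) :=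
    setLIntegral_prod_eq_ofReal (Φ := fun z : ℝ × E =>
        (T⁻¹ * ‖u z.1 z.2‖ ^ 2 + ‖fderiv ℝ (u z.1) z.2‖ ^ 2) * Real.exp (-‖z.2‖ ^ 2 / (4 * z.1)))
      (by linarith) (isCompact_closedBall _ _) measurableSet_ball ball_subset_closedBall
      (hnull _ (by positivity)) ((hΦ.mono (hLsub.trans hKO)).mul hW) (fun z _ => by positivity)
  have eX : (∫⁻ p in Icc 0 T ×ˢ closedBall (0 : E) r,
        ENNReal.ofReal (T⁻¹ * ‖u p.1 p.2‖ ^ 2 + ‖fderiv ℝ (u p.1) p.2‖ ^ 2)) =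
      ENNReal.ofReal (∫ t in (0 : ℝ)..T, ∫ x in ball (0 : E) r,
        (T⁻¹ * ‖u t x‖ ^ 2 + ‖fderiv ℝ (u t) x‖ ^ 2)) :=
    setLIntegral_prod_eq_ofReal (Φ := fun z : ℝ × E =>
        T⁻¹ * ‖u z.1 z.2‖ ^ 2 + ‖fderiv ℝ (u z.1) z.2‖ ^ 2) hT.le (isCompact_closedBall _ _)
      measurableSet_ball ball_subset_closedBall (hnull _ hr) (hΦ.mono hKO)
      (fun z _ => by positivity)
  have eY : (∫⁻ x in closedBall (0 : E) r, ENNReal.ofReal (‖u 0 x‖ ^ 2 *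
        (t₁ ^ (-(Module.finrank ℝ E : ℝ) / 2) * Real.exp (-‖x‖ ^ 2 / (4 * t₁))))) =
      ENNReal.ofReal (∫ x in ball (0 : E) r, ‖u 0 x‖ ^ 2 *
        (t₁ ^ (-(Module.finrank ℝ E : ℝ) / 2) * Real.exp (-‖x‖ ^ 2 / (4 * t₁)))) :=
    setLIntegral_eq_ofReal (isCompact_closedBall _ _) measurableSet_ball ball_subset_closedBall
      (hnull _ hr) hψ (fun x _ => by positivity)
  rw [eL, eX, eY]
  -- assemble in `ℝ≥0∞`
  have hX0 : 0 ≤ ∫ t in (0 : ℝ)..T, ∫ x in ball (0 : E) r,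
      (T⁻¹ * ‖u t x‖ ^ 2 + ‖fderiv ℝ (u t) x‖ ^ 2) :=
    intervalIntegral.integral_nonneg hT.le fun t _ =>
      setIntegral_nonneg measurableSet_ball fun x _ => by positivity
  have hY0 : 0 ≤ ∫ x in ball (0 : E) r, ‖u 0 x‖ ^ 2 *
      (t₁ ^ (-(Module.finrank ℝ E : ℝ) / 2) * Real.exp (-‖x‖ ^ 2 / (4 * t₁))) :=
    setIntegral_nonneg measurableSet_ball fun x _ => by positivity
  have he1 : 0 ≤ Real.exp (-r ^ 2 / (500 * t₀)) := (Real.exp_pos _).le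
  have he2 : 0 ≤ t₀ ^ ((Module.finrank ℝ E : ℝ) / 2) *
      Real.exp (K * (r ^ 2 / t₀) * Real.log (Real.exp 1 * t₀ / t₁)) := by positivity
  rw [← ENNReal.ofReal_mul he1, ← ENNReal.ofReal_mul he2, ← ENNReal.ofReal_add
    (mul_nonneg he1 hX0) (mul_nonneg he2 hY0), ← ENNReal.ofReal_mul hK.le]
  exact ENNReal.ofReal_le_ofReal key

end Lintegral

end TaoCarleman

end Literature.Analysis.FluidPDE

end
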